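import Summits.QuantumFields.BalabanUV.Beta.D1BFx.LandauDictionaryHWeighted
import Summits.QuantumFields.BalabanUV.Beta.D1BFx.BoundedSuperposition

/-!
# `BalabanUV.Beta.D1BFx.LandauResolventSuperposition` — road «BF-x» for binder row D1, slot (K), dictionary brick **B6′ (H-SUPERPOS)**, part 2:
# FROM X₁a ALONE — the R-weighted average-source column `Ga𝒬ᵀω` IS the typed superposition `H(𝒬Ga𝒬ᵀω)`, its constraint multiplier IS
# `Φ(𝒬Ga𝒬ᵀω)`, and hence **the coarse identity `c·ω = a′·(𝒬Ga𝒬ᵀω) + wΦ ⋆ (𝒬Ga𝒬ᵀω)`** — debt X₁b of K-R1-SPEC v2 §4 AS A THEOREM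

HONEST FRAMING (cell contract, verbatim): «discharging `BetaPertH` makes Bałaban's UV stability UNCONDITIONAL — a real constructive-QFT
result; it is NOT the continuum limit and NOT the Clay problem.»  HONEST DEPENDENCY (verbatim): «continuum YM on T⁴ ⇐ BetaPertH ∧ nine
spine estimates (0/9 proved); BetaPertH ⇐ (D1) ∧ (D4) ∧ CAP+tail; G-an2-4 gates asym, D1 and NE2/3/4.»  THIS MODULE DISCHARGES NOTHING of
D1 / BetaPertH: it composes BY NAME leaf-06-g6's weighted verification `LandauDictionaryHWeighted.solvesKKT_superposed_w` /
`tempered_superposed_w` (brick B6, ρ-g5-5 shape) with this lineage's `BoundedSuperposition.eq_Hop_of_solvesKKT_bdd` / `hasSum_Hop_bdd` /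
`hasSum_Φop_bdd` (brick B6′ part 1).  The vector-leg equation X₁a enters as a DISPLAYED HYPOTHESIS `hX1a` with free coefficients `(r, a′, c)`
(truth for `Ga = Kinf`: `r = 2, a′ = 2a/n⁸, c = 2` — `X1-SPEC.md` §0); it is NOT asserted.  One data `def` with a body ([our object] `unitSrc`);
nothing is cited; 0 sorry.  NOT summit progress; NOT BetaPertH, NOT continuum, NOT Clay.

ABSOLUTE RULE (cell, verbatim): «No internally-minted statement may enter as a cited fact. Every hypothesis is either kernel-proved in this
package or a verbatim quotation of a PUBLISHED theorem with page reference. The manuscript(s) under audit are NOT citable for their own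
disputed steps — they are the thing under adjudication; programme-internal (2001/route/tribunal) claims are never citable.»

WHY (owner ruling ρ-g5-2; `HOME/b2b-balaban-beta-d1-p2/DICT-BRICKS.md` v1.2 brick B6′; K-R1-SPEC v2 §2 (D-H), §4).  B6 (`wH_eq_HRcol_w`) reaches
the dictionary line (D-H) `wH = Ga𝒬ᵀCun` from TWO displayed identities, X₁a (the equation of `Ga`) and X₁b (`𝒬·Ga𝒬ᵀCun = 1`).  The second is
not independent: the column `A := Ga𝒬ᵀω` with ANY bounded coarse source `ω` solves the typed KKT system with its OWN block averages
`c_ω := 𝒬A` as data (B6, from X₁a alone), the typed superposition `(H c_ω, Φ c_ω, M c_ω)` solves the same system (B6′ part 1), both are tempered,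
so UNIQUENESS identifies them — and the multiplier line of that identification, `c·ω − a′·c_ω = Φ c_ω`, read at a unit source `ω = e_{(l₀,y₀)}`,
IS the coarse identity `(wΦ⋆ + a′)·(𝒬Ga𝒬ᵀ) = c·1` that X₁b asserted (with its constant computed, not guessed).  So slot (K)'s dictionary owes
X₁a ONLY.

CONTENT (block side `n ≥ 1`, `a > 0`, `r ≠ 0`; all [folklore] / [our object]).
* §1 `abs_contourSum_le` (finite-stencil bound), `exists_bound_avgData` (the data `c_ω := 𝒬(Ga𝒬ᵀω)` is bounded for bounded `ω` and decaying `Ga`).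
* §2 **`dictH_superposed`**: `Ga𝒬ᵀω = H c_ω`, `c•ω − a′•c_ω = Φ c_ω`, `−(r n²)·G′R δ(Ga𝒬ᵀω) = M c_ω` (functions), ⟸ `hX1a` displayed;
  entrywise forms `kerOp₁_eq_tsum_wH` ((D-H) through the source sums: `(Ga𝒬ᵀω)(κ,x) = Σ'_y Σ_l wH κ l (x − n•y)·c_ω l y`) and
  `coarse_identity` (`c·ω κ y = a′·c_ω κ y + Σ'_{y′} Σ_l wΦ κ l (y − y′)·c_ω l y′`).
* §3 the unit source `unitSrc l₀ y₀` and **`X1b_of_X1a`**: `c·δ_{(κ,y),(l₀,y₀)} = a′·(𝒬Ga𝒬ᵀe_{(l₀,y₀)})(κ,y) + Σ'_{y′} Σ_l wΦ κ l (y − y′)·(𝒬Ga𝒬ᵀe_{(l₀,y₀)})(l,y′)`.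
Unit `b2b-balaban-beta-d1-p2` (road owner, gen 5).
-/

namespace Summit.QuantumFields.BalabanUV.Beta.D1BFx.LandauResolventSuperposition

open Finset
open scoped BigOperators
open Literature.MathematicalPhysics.QuantumFieldTheory.Balaban1983to89
open Literature.MathematicalPhysics.QuantumFieldTheory.Balaban1983to89.Beta
open ExpKernelCalculus (Site MKer Decays Zl Zl_nonneg)
open AffineAveraging (Form0 Form1 box toSite unitVec dz curv curvAdj codiff₁ blockSum contourSum)
open AffineReproduction (contourSumAdj)
open KKTFluctuationKernel (delta1)
open KKTFluctuationUnique (SolvesKKT Tempered0 Tempered1)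
open KernelSpecInstance (wH wΦ wM Hop Φop Mop)
open KernelFormOperators (kerOp₁ Rf abs_kerOp₁_le)
open TowerEquationForms (Gf)
open LandauDictionaryH (abs_contourSumAdj_le)
open LandauDictionaryHWeighted (solvesKKT_superposed_w tempered_superposed_w)
open BoundedSuperposition (eq_Hop_of_solvesKKT_bdd hasSum_Hop_bdd hasSum_Φop_bdd)

noncomputable section

variable (n : ℕ) [NeZero n] (a : ℝ)

/-! ## §1 The block averages of the candidate column are bounded -/

omit [NeZero n] in
/-- [folklore] A uniform bound passes through the straight-contour block sum: `|𝒬A κ y| ≤ #box·n·B`. -/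
theorem abs_contourSum_le {A : Form1 4 ℝ} {B : ℝ} (hA : ∀ κ x, |A κ x| ≤ B) (κ : Fin 4) (y : Site 4) :
    |contourSum n A κ y| ≤ ((box 4 n).card : ℝ) * n * B := by
  simp only [contourSum]
  calc |∑ b ∈ box 4 n, ∑ s ∈ Finset.range n, A κ ((n : ℤ) • y + toSite b + (s : ℤ) • unitVec κ)|
      ≤ ∑ b ∈ box 4 n, |∑ s ∈ Finset.range n, A κ ((n : ℤ) • y + toSite b + (s : ℤ) • unitVec κ)| := Finset.abs_sum_le_sum_abs _ _
    _ ≤ ∑ b ∈ box 4 n, ∑ s ∈ Finset.range n, |A κ ((n : ℤ) • y + toSite b + (s : ℤ) • unitVec κ)| :=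
        Finset.sum_le_sum fun b _ => Finset.abs_sum_le_sum_abs _ _
    _ ≤ ∑ b ∈ box 4 n, ∑ s ∈ Finset.range n, B := Finset.sum_le_sum fun b _ => Finset.sum_le_sum fun s _ => hA _ _
    _ = ((box 4 n).card : ℝ) * n * B := by
        rw [Finset.sum_const, Finset.sum_const, Finset.card_range, nsmul_eq_mul, nsmul_eq_mul]; ring

variable {Ga : MKer 4 (Fin 4)} {C δ Mω : ℝ} {ω : Form1 4 ℝ} {r a' c : ℝ}

omit [NeZero n] in
/-- [folklore] **The data `c_ω := 𝒬(Ga𝒬ᵀω)` is bounded** for a decaying `Ga` and a bounded coarse source `ω`. -/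
theorem exists_bound_avgData (hGa : Decays Ga C δ) (hδ : 0 < δ) (hω : ∀ κ y, |ω κ y| ≤ Mω) :
    ∃ B : ℝ, ∀ κ y, |contourSum n (kerOp₁ Ga (contourSumAdj n ω)) κ y| ≤ B :=
  ⟨_, fun κ y => abs_contourSum_le n (fun κ x => abs_kerOp₁_le hGa hδ (fun l z => abs_contourSumAdj_le n hω l z) κ x) κ y⟩

/-! ## §2 The dictionary line (D-H) by uniqueness against the typed superposition, from X₁a alone -/

/-- [folklore] **(D-H) FROM X₁a ALONE.**  For every bounded coarse source `ω`, the R-weighted column `A := Ga𝒬ᵀω`, its multiplier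
`c•ω − a′•𝒬A` and its gauge multiplier `−(r n²)·G′R δA` ARE the typed superposition `(H, Φ, M)` against the data `𝒬A` — by
`solvesKKT_superposed_w` (leaf-06-g6, from the displayed X₁a in the weighted shape ρ-g5-5) + `eq_Hop_of_solvesKKT_bdd` (uniqueness). -/
theorem dictH_superposed (ha : 0 < a) (hr : r ≠ 0) (hGa : Decays Ga C δ) (hδ : 0 < δ) (hω : ∀ κ y, |ω κ y| ≤ Mω)
    (hX1a : ∀ (m : Fin 4) (z : Site 4) (κ : Fin 4) (x : Site 4),
      curvAdj (curv (fun κ' p => Ga p z κ' m)) κ x = c * delta1 m z κ x - r * dz (Rf n a (codiff₁ (fun κ' p => Ga p z κ' m))) κ x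
        - a' * contourSumAdj n (contourSum n (fun κ' p => Ga p z κ' m)) κ x) :
    kerOp₁ Ga (contourSumAdj n ω) = Hop (N := n) (contourSum n (kerOp₁ Ga (contourSumAdj n ω)))
      ∧ (fun κ y => c * ω κ y - a' * contourSum n (kerOp₁ Ga (contourSumAdj n ω)) κ y)
          = Φop (N := n) (contourSum n (kerOp₁ Ga (contourSumAdj n ω)))
      ∧ (fun p => -(r * (n : ℝ) ^ 2) * Gf n a (Rf n a (codiff₁ (kerOp₁ Ga (contourSumAdj n ω)))) p)
          = Mop (N := n) (contourSum n (kerOp₁ Ga (contourSumAdj n ω))) := by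
  obtain ⟨B, hB⟩ := exists_bound_avgData n hGa hδ hω
  obtain ⟨hA, hφ, hμ⟩ := tempered_superposed_w n a (r := r) (a' := a') (c := c) ha hGa hδ hω
  exact eq_Hop_of_solvesKKT_bdd hB (solvesKKT_superposed_w n a ha hr hGa hδ hω hX1a) hA hφ hμ

/-- [folklore] **(D-H) THROUGH THE SOURCE SUMS**: `(Ga𝒬ᵀω)(κ, x) = Σ'_y Σ_l wH κ l (x − n•y) · (𝒬Ga𝒬ᵀω)(l, y)` — i.e. `Ga𝒬ᵀ = wH ⋆ (𝒬Ga𝒬ᵀ)`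
columnwise, the typed resolvent's minimiser kernel dressing the coarse operator `𝒬Ga𝒬ᵀ`. -/
theorem kerOp₁_eq_tsum_wH (ha : 0 < a) (hr : r ≠ 0) (hGa : Decays Ga C δ) (hδ : 0 < δ) (hω : ∀ κ y, |ω κ y| ≤ Mω)
    (hX1a : ∀ (m : Fin 4) (z : Site 4) (κ : Fin 4) (x : Site 4),
      curvAdj (curv (fun κ' p => Ga p z κ' m)) κ x = c * delta1 m z κ x - r * dz (Rf n a (codiff₁ (fun κ' p => Ga p z κ' m))) κ x
        - a' * contourSumAdj n (contourSum n (fun κ' p => Ga p z κ' m)) κ x)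
    (κ : Fin 4) (x : Site 4) :
    kerOp₁ Ga (contourSumAdj n ω) κ x
      = ∑' y : Site 4, ∑ l, wH (N := n) κ l (x - (n : ℤ) • y) * contourSum n (kerOp₁ Ga (contourSumAdj n ω)) l y := by
  obtain ⟨B, hB⟩ := exists_bound_avgData n hGa hδ hω
  obtain ⟨h1, -, -⟩ := dictH_superposed n a ha hr hGa hδ hω hX1a
  conv_lhs => rw [h1]
  exact ((hasSum_Hop_bdd (N := n) hB κ x).tsum_eq).symm

/-- [folklore] **THE COARSE IDENTITY, GENERAL SOURCE**: `c·ω κ y = a′·c_ω κ y + Σ'_{y′} Σ_l wΦ κ l (y − y′)·c_ω l y′`, `c_ω := 𝒬(Ga𝒬ᵀω)` —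
the multiplier line of `dictH_superposed` read through `hasSum_Φop_bdd`. -/
theorem coarse_identity (ha : 0 < a) (hr : r ≠ 0) (hGa : Decays Ga C δ) (hδ : 0 < δ) (hω : ∀ κ y, |ω κ y| ≤ Mω)
    (hX1a : ∀ (m : Fin 4) (z : Site 4) (κ : Fin 4) (x : Site 4),
      curvAdj (curv (fun κ' p => Ga p z κ' m)) κ x = c * delta1 m z κ x - r * dz (Rf n a (codiff₁ (fun κ' p => Ga p z κ' m))) κ x
        - a' * contourSumAdj n (contourSum n (fun κ' p => Ga p z κ' m)) κ x)
    (κ : Fin 4) (y : Site 4) :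
    c * ω κ y = a' * contourSum n (kerOp₁ Ga (contourSumAdj n ω)) κ y
      + ∑' y' : Site 4, ∑ l, wΦ (N := n) κ l (y - y') * contourSum n (kerOp₁ Ga (contourSumAdj n ω)) l y' := by
  obtain ⟨B, hB⟩ := exists_bound_avgData n hGa hδ hω
  obtain ⟨-, h2, -⟩ := dictH_superposed n a ha hr hGa hδ hω hX1a
  have h := congr_fun (congr_fun h2 κ) y
  rw [← (hasSum_Φop_bdd (N := n) hB κ y).tsum_eq] at h
  linarith

/-! ## §3 X₁b as a theorem: the unit source -/

/-- [our object] The unit coarse source at the coarse bond `(l₀, y₀)`. -/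
def unitSrc (l₀ : Fin 4) (y₀ : Site 4) : Form1 4 ℝ := fun κ y => if y = y₀ ∧ κ = l₀ then 1 else 0

/-- [folklore] The unit source is bounded by `1`. -/
theorem abs_unitSrc_le (l₀ : Fin 4) (y₀ : Site 4) (κ : Fin 4) (y : Site 4) : |unitSrc l₀ y₀ κ y| ≤ 1 := by
  unfold unitSrc; split_ifs <;> simp

/-- [folklore] **X₁b FROM X₁a** (K-R1-SPEC v2 §4; owner ruling ρ-g5-2): for every coarse bond `(l₀, y₀)`,
`c·δ_{(κ,y),(l₀,y₀)} = a′·Φ̃((κ,y),(l₀,y₀)) + Σ'_{y′} Σ_l wΦ κ l (y − y′)·Φ̃((l,y′),(l₀,y₀))` with `Φ̃ := 𝒬Ga𝒬ᵀ` (the column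
`𝒬(Ga𝒬ᵀe_{(l₀,y₀)})`) — i.e. `(wΦ⋆ + a′)·(𝒬Ga𝒬ᵀ) = c·1`: the typed constraint multiplier, shifted by `a′`, INVERTS the R-weighted coarse
operator (up to `c`).  With the truth `c = 2, a′ = 2a/n⁸` this is `(½wΦ + a/n⁸)·(𝒬Ga𝒬ᵀ) = 1`, i.e. the tree's `CoarseLeg.Cun = (n⁸/2)wΦ + a`
satisfies `Cun·(𝒬Ga𝒬ᵀ) = n⁸·1`. -/
theorem X1b_of_X1a (ha : 0 < a) (hr : r ≠ 0) (hGa : Decays Ga C δ) (hδ : 0 < δ)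
    (hX1a : ∀ (m : Fin 4) (z : Site 4) (κ : Fin 4) (x : Site 4),
      curvAdj (curv (fun κ' p => Ga p z κ' m)) κ x = c * delta1 m z κ x - r * dz (Rf n a (codiff₁ (fun κ' p => Ga p z κ' m))) κ x
        - a' * contourSumAdj n (contourSum n (fun κ' p => Ga p z κ' m)) κ x)
    (l₀ : Fin 4) (y₀ : Site 4) (κ : Fin 4) (y : Site 4) :
    c * (if y = y₀ ∧ κ = l₀ then 1 else 0)
      = a' * contourSum n (kerOp₁ Ga (contourSumAdj n (unitSrc l₀ y₀))) κ y
        + ∑' y' : Site 4, ∑ l, wΦ (N := n) κ l (y - y') * contourSum n (kerOp₁ Ga (contourSumAdj n (unitSrc l₀ y₀))) l y' :=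
  coarse_identity n a ha hr hGa hδ (abs_unitSrc_le l₀ y₀) hX1a κ y

end

end Summit.QuantumFields.BalabanUV.Beta.D1BFx.LandauResolventSuperposition
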